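/-
Copyright (c) 2026 the pub-hodgecm-mathlib formalisation cell (harness21).  Prover seat hodgecm-mathlib-K2E3-p32 (g0), HCML Track B «K2-LIT» (close-out strike line L4
`stub_StCharTS`), h413 = `stmt-HodgeConjecture-24833`, line `K2_E3_EllipticInputs`, PART «SC» socket (SC-an)₂ `sig_K2E3SupercuspidalTruncatedCharAnalyticTwo`, the (M5h₂)
chain (dealer K2E3-plan (g4) EMIT #1 2026-09-04T14:52:25Z, deal D137): the `U(1,1)` twin of ★ `K2E3CuspFormCancellationU3` ∕ ★ `K2E3CuspFormCancellationU3LevelOne`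
(K2E3-p21 (g3)) — HARISH-CHANDRA'S THEOREM 20 «cusp-form cancellation» FOR THE MODEL `U(σ, Φ₂)(K)`, at the conjugate level `K_m(y⁻¹)` and on the full level `K₁`.  2026-09-04.
-/
import Summits.HodgeConjecture.HodgeConjecture.Theorems.K2E3CuspFormCancellationLevelOne   -- ★ (T20-e1′) `cuspForm_cancellation_levelOne` (abstract `K₀(y) ↝ K₁` upgrade); brings ★ (T20-e1) Core `cuspForm_cancellation_conjLevel`, ★ (T20-e2) Heights
import Summits.HodgeConjecture.HodgeConjecture.Theorems.K2E3CuspFormCancellationU2Inputs   -- ★ FILE 2 (this seat): the group-side hypotheses at `U(σ,Φ₂)(K)`; brings ★ FILE 1 U2Torus, ★ (T20-c), ★ `F0P3cIwahoriDatumU2Alg`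
import Summits.HodgeConjecture.HodgeConjecture.Theorems.F0P3cIwahoriDatumU2             -- ★ ANY-RANK topology of the levels: `isCompact_level`, `isOpen_level` (`K_γ ∩ U(σ,Φ_N)` compact open)
import Literature.NumberTheory.Automorphic.ReductionTheoryGLnConjugation                    -- ★ `isClosed_upperUnitriangular` (`N` is closed)
import HarnessLib

/-!
# h413 ∕ Track B «K2-LIT», (SC-an)₂ Theorem-20 line at `U(1,1)` — DISCHARGE FILE 3: THEOREM 20 (CUSP-FORM CANCELLATION) FOR THE RANK-ONE MODEL `U(σ, Φ₂)(K)`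
# `y ∈ Ω_s`, `x ∉ Ω_{m_C + (m + 2s + 4m_C) + s}` ⟹ `∫_{K_m ∩ y⁻¹ K_m y} f(x y k) dμ(k) = 0`, and on the full level `K₁ = U ∩ GL₂(𝒪)`:
# `∃ m_C, ∀ s y, y ∈ Ω_s → ∀ x ∉ Ω_{m_C + (1 + 2s + 4m_C) + s}, ∫_{K₁} f(x k y) dμ(k) = 0`  (Harish-Chandra 1970, Part VII §2 Theorem 20 p. 70; §3 p. 71; §8 pp. 80–84)

Cell `pub/hodgecm-mathlib`, crux H413 = `stmt-HodgeConjecture-24833`, route of record `HCCMUnconditional`; chair K2-lead (g2), LINE-LEAD∕dealer K2E3-plan (g4),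
architect K2E3-p25 (g3).  THEOREMS ONLY (no `def`, no `instance`, no `notation`, no named-fact hypothesis, no `sorry`); lane `--supports stmt-HodgeConjecture-24833 --as helper`,
count-neutral.

THE PORT.  This is ★ `K2E3CuspFormCancellationU3` §1–§2 + ★ `K2E3CuspFormCancellationU3LevelOne` §1–§2 (K2E3-p21 (g3)) with `Fin 3 ↦ Fin 2`, `Φ₃ ↦ Φ₂`, TOKEN FOR TOKEN.  The abstract
★ (T20-e1) `K2E3CuspFormCancellationCore.cuspForm_cancellation_conjLevel` and ★ (T20-e1′) `K2E3CuspFormCancellationLevelOne.cuspForm_cancellation_levelOne` are THEOREM 20 for an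
abstract group with ≈ 20 structural hypotheses (height balls, Iwahori orders, `A = A⁺ ∪ A⁻`, contractions, Lemma 54, deep levels, …); the radius `m_C + (m + 2s + 4m_C) + s` is the
ABSTRACT theorem's and does not depend on the rank.  Here `G := U = ↥(unitaryGroupOfForm σ J)`, `J = Φ₂`, over a non-archimedean local field `K` (compatible `Valued K ℤᵐ⁰` ∕
`ValuativeRel`), `σ` a continuous isometric ring endomorphism, `ϖ` a uniformiser; `Ω` = any family with the height-ball membership of ★ p856390 (`hmem`, `hinv`, `hmul`);
`K₀ := K_{|ϖ|^m} ∩ U`, `K′ := K₀ ⊓ y⁻¹K₀y`, `T := torusU`, `N := unipotentU`, `N̄ := w₀ N w₀`, `A^± := {diag d : |d₀| ≷ 1}`, `L j := K_{|ϖ|^j} ∩ U`; EVERY structural hypothesis is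
discharged BY NAME exactly as at `N = 3`: `hK₀` ★ FILE 2 `coe_level_subset_heightBall_zero` · `hK'y` ★ FILE 2 `mem_inf_map_conj_inv_iff` · `hdeep` ★ (T20-c) §Twist (any rank)
`conj_mem_comap_congruenceGL_of_heightBall` + `comap_congruenceGL_le_inf_map_conj_of_heightBall` · `hK'o`, `hK'c` ★ ANY-RANK `F0P3cIwahoriDatumU2.isCompact_level` ∕ `isOpen_level`
(replacing the `Φ₃`-only ★ `isCompact_isOpen_comap_congruenceGL`) + conjugation · `hN` ★ `isClosed_upperUnitriangular` · `hNbar` · `hAcover` ★ FILE 2 `torusU_mem_plus_or_minus` ·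
`hIw`, `hIw'` ★ FILE 1 §3 `exists_iwahori_factorisations_of_mem_level` (any rank, over ★ `F0P3cIwahoriDatumU2.coe_level_eq_mul`) · `hT`, `hnormN`, `hnormNbar`, `h54N`, `h54Nbar`,
`hplusV`, `hminusV`, `hplusC`, `hminusC` ★ FILE 2.  What REMAINS as hypotheses is print's datum `f ∈ Φ_C`: `f` continuous, `supp f ⊆ C·T`, cuspidal along `N` and `N̄`.
* §1 topology: `isClosed_coe_N`, `isClosed_coe_Nbar`, `isCompact_isOpen_conjLevel` (`K₀ ⊓ y⁻¹K₀y` is compact open).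
* §2 **`cuspForm_cancellation_U2`** — THEOREM 20 for `U(σ, Φ₂)(K)` at the conjugate level `K₀(y⁻¹)` (`μ` a left Haar measure).
* §3 **`cuspForm_cancellation_levelOne_U2`** — the FULL-LEVEL form `∫_{K₁} f(x k y) dμ(k) = 0`, `K₁ := K_{γ=1} ∩ U = U ∩ GL₂(𝒪)`, for `μ` left AND right invariant, at the fixed
  level `m = 1`; **`cuspForm_cancellation_levelOne_U2_of_isCompact`** ∕ **`cuspForm_cancellation_U2_of_isCompact`** — the same with `Ω : CompactExhaustion U` and the support
  datum `∃ C, IsCompact C ∧ ∀ x, f x ≠ 0 → x ∈ C * ↑T` (the junction shapes the [M4]₂ brick `K2E3SupercuspidalTruncatedCharThm20Two` consumes).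

HONEST LABEL.  HC_CM is proved only modulo the 7 printed citations (2 remaining named inputs: hLiu418 = `stmt-HodgeConjecture-24832`, h413 = `stmt-HodgeConjecture-24833`)
until rung 0 closes; count-neutral helper (Theorem 20 is an intermediate of (SC-an)₂, not a printed citation of HC_CM); (SC-an)₂ is NOT ★ until COLL₂ + NC₂ + the whole
(M5h₂) chain land.

## References
* [HarishChandra1970] Harish-Chandra (notes by G. van Dijk), *Harmonic Analysis on Reductive p-adic Groups*, LNM 162 (1970), Part VII §2 Theorem 20 p. 70; §3 p. 71
  («`∫_{K₁} f_γ(x k y₀) dk = 0` unless `1 + σ(xk) ≤ c(1+σ(C_γ))(1+σ(y₀))`»); §8 pp. 80–84.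
* [Casselman1995] W. Casselman, *Introduction to the theory of admissible representations of `p`-adic reductive groups* (1995 notes), Prop. 1.4.3–1.4.4.
* [Rogawski1990] J. D. Rogawski, *Automorphic Representations of Unitary Groups in Three Variables*, Ann. of Math. Stud. 123 (1990), §1.9–§1.10 pp. 8–9; §12.2 p. 173.
* [Folland1995] G. B. Folland, *A Course in Abstract Harmonic Analysis* (1995), §2.4 (unimodular groups).
-/

set_option autoImplicit false
set_option linter.dupNamespace false  -- the mandated namespace repeats the single-problem summit's segment (`HodgeConjecture.HodgeConjecture`)

noncomputable section

open scoped MatrixGroups WithZero Pointwise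
open MeasureTheory Topology ValuativeRel Matrix
open Literature.NumberTheory.Automorphic Literature.NumberTheory.Automorphic.UnitaryGroup
open Summit.HodgeConjecture.HodgeConjecture.Cruxes.H413.K2E3CuspFormCancellationU2Inputs
open Summit.HodgeConjecture.HodgeConjecture.Cruxes.H413.K2E3CuspFormCancellationInputsAnyRank

namespace Summit.HodgeConjecture.HodgeConjecture.Cruxes.H413.K2E3CuspFormCancellationU2LevelOne

/-! ## §1 Topology: `N`, `N̄` are closed (any rank); `K₀(y⁻¹)` is compact open -/

section AnyRankTop

variable {K : Type*} [Field K] [Valued K ℤᵐ⁰] [ValuativeRel K] [IsNonarchimedeanLocalField K]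
  (σ : K →+* K) {N : ℕ} {J : Matrix (Fin N) (Fin N) K}

/-- `N = unipotentU` is closed in `U(σ, Φ_N)(K)` (any rank; ★ `isClosed_upperUnitriangular` pulled back along the closed-subgroup inclusion; the `Φ₃` namesake is ★
`K2E3CuspFormCancellationU3.isClosed_coe_N`). [cite: Rogawski1990, §1.10 p. 9] -/
theorem isClosed_coe_N (hJ : J = (StdForm.antidiagonal N).over K) :
    IsClosed (((borelTriple σ J hJ).N : Subgroup ↥(unitaryGroupOfForm σ J)) : Set ↥(unitaryGroupOfForm σ J)) := by
  haveI : T2Space K := (Literature.NumberTheory.GaloisRepresentations.IsNonarchimedeanLocalField.isLocalField K).toT2Space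
  exact (isClosed_upperUnitriangular (n := N) (R := K)).preimage continuous_subtype_val

/-- `N̄ = w₀ N w₀⁻¹` is closed in `U(σ, Φ_N)(K)` (any rank; the image of the closed `N` under the homeomorphism `conj w₀`). [cite: Rogawski1990, §1.10 p. 9] -/
theorem isClosed_coe_Nbar (hJ : J = (StdForm.antidiagonal N).over K) :
    IsClosed ((((borelTriple σ J hJ).N).map (MulAut.conj (weylLongU σ hJ)).toMonoidHom : Subgroup ↥(unitaryGroupOfForm σ J)) : Set ↥(unitaryGroupOfForm σ J)) := by
  rw [Subgroup.coe_map]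
  have hφ : ((MulAut.conj (weylLongU σ hJ)).toMonoidHom : ↥(unitaryGroupOfForm σ J) → ↥(unitaryGroupOfForm σ J)) =
      (Homeomorph.mulLeft (weylLongU σ hJ)).trans (Homeomorph.mulRight (weylLongU σ hJ)⁻¹) := by
    funext x; simp
  rw [hφ]
  exact (Homeomorph.isClosed_image _).2 (isClosed_coe_N σ hJ)

end AnyRankTop

section Model

variable {K : Type*} [Field K] [Valued K ℤᵐ⁰] [ValuativeRel K] [(Valued.v : Valuation K ℤᵐ⁰).Compatible] [IsNonarchimedeanLocalField K]
  (σ : K →+* K) (hσc : Continuous σ) (hσv : ∀ x, Valued.v (σ x) = Valued.v x)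
  {J : Matrix (Fin 2) (Fin 2) K} (hJ : J = (StdForm.antidiagonal 2).over K)

omit [(Valued.v : Valuation K ℤᵐ⁰).Compatible] in
include hσc in
/-- **`K₀(y⁻¹) = K₀ ⊓ y⁻¹K₀y` IS COMPACT OPEN** for `K₀ = K_γ ∩ U`, `γ ≠ 0` (★ any-rank `F0P3cIwahoriDatumU2.isCompact_level` ∕ `isOpen_level`; the conjugate is the image under the
homeomorphism `conj y⁻¹`, and a closed subset of the compact `K₀`). [cite: HarishChandra1970, Part VII §8 p. 80] [cite: Casselman1995, Prop. 1.4.4] -/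
theorem isCompact_isOpen_conjLevel {γ : ValueGroupWithZero K} (hγ : γ ≠ 0) (y : ↥(unitaryGroupOfForm σ J)) :
    IsCompact (((congruenceGL 2 γ).comap (unitaryGroupOfForm σ J).subtype ⊓
        ((congruenceGL 2 γ).comap (unitaryGroupOfForm σ J).subtype).map (MulAut.conj y⁻¹).toMonoidHom : Subgroup ↥(unitaryGroupOfForm σ J)) :
          Set ↥(unitaryGroupOfForm σ J)) ∧
      IsOpen (((congruenceGL 2 γ).comap (unitaryGroupOfForm σ J).subtype ⊓
        ((congruenceGL 2 γ).comap (unitaryGroupOfForm σ J).subtype).map (MulAut.conj y⁻¹).toMonoidHom : Subgroup ↥(unitaryGroupOfForm σ J)) :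
          Set ↥(unitaryGroupOfForm σ J)) := by
  haveI : T2Space K := (Literature.NumberTheory.GaloisRepresentations.IsNonarchimedeanLocalField.isLocalField K).toT2Space
  obtain ⟨hKc, hKo⟩ := show IsCompact _ ∧ IsOpen _ from ⟨F0P3cIwahoriDatumU2.isCompact_level σ hσc γ (J := J), F0P3cIwahoriDatumU2.isOpen_level σ hγ (J := J)⟩
  have hφ : ((MulAut.conj y⁻¹).toMonoidHom : ↥(unitaryGroupOfForm σ J) → ↥(unitaryGroupOfForm σ J)) =
      (Homeomorph.mulLeft y⁻¹).trans (Homeomorph.mulRight y⁻¹⁻¹) := by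
    funext x; simp
  have hKc' : IsCompact ((((congruenceGL 2 γ).comap (unitaryGroupOfForm σ J).subtype).map (MulAut.conj y⁻¹).toMonoidHom : Subgroup ↥(unitaryGroupOfForm σ J)) :
      Set ↥(unitaryGroupOfForm σ J)) := by
    rw [Subgroup.coe_map, hφ]; exact hKc.image (Homeomorph.continuous _)
  have hKo' : IsOpen ((((congruenceGL 2 γ).comap (unitaryGroupOfForm σ J).subtype).map (MulAut.conj y⁻¹).toMonoidHom : Subgroup ↥(unitaryGroupOfForm σ J)) :
      Set ↥(unitaryGroupOfForm σ J)) := by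
    rw [Subgroup.coe_map, hφ]; exact (Homeomorph.isOpen_image _).2 hKo
  rw [Subgroup.coe_inf]
  exact ⟨hKc.inter_right hKc'.isClosed, hKo.inter hKo'⟩

/-! ## §2 THEOREM 20 for `U(σ, Φ₂)(K)` at the conjugate level `K₀(y⁻¹)` -/

section ConjLevel

variable [MeasurableSpace ↥(unitaryGroupOfForm σ J)] [BorelSpace ↥(unitaryGroupOfForm σ J)]
  [SecondCountableTopology ↥(unitaryGroupOfForm σ J)] [LocallyCompactSpace ↥(unitaryGroupOfForm σ J)]
  (μ : Measure ↥(unitaryGroupOfForm σ J)) [μ.IsHaarMeasure]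
  (ν : Measure ↥((borelTriple σ J hJ).N)) [SFinite ν] [ν.IsOpenPosMeasure] [IsFiniteMeasureOnCompacts ν] [ν.IsMulLeftInvariant]
  (νbar : Measure ↥(((borelTriple σ J hJ).N).map (MulAut.conj (weylLongU σ hJ)).toMonoidHom))
  [SFinite νbar] [νbar.IsOpenPosMeasure] [IsFiniteMeasureOnCompacts νbar] [νbar.IsMulLeftInvariant]
  {ϖ : K} (hϖ : Valued.v ϖ = WithZero.exp (-1 : ℤ))
  (Ω : ℕ → Set ↥(unitaryGroupOfForm σ J))
  (hmem : ∀ (m : ℕ) (g : ↥(unitaryGroupOfForm σ J)), g ∈ Ω m ↔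
    (∀ i j, Valued.v (ϖ ^ m * ((g : GL (Fin 2) K) : Matrix (Fin 2) (Fin 2) K) i j) ≤ 1) ∧
      ∀ i j, Valued.v (ϖ ^ m * (((g : GL (Fin 2) K)⁻¹ : GL (Fin 2) K) : Matrix (Fin 2) (Fin 2) K) i j) ≤ 1)
  (hinv : ∀ (m : ℕ) (g : ↥(unitaryGroupOfForm σ J)), g ∈ Ω m → g⁻¹ ∈ Ω m)
  (hmul : ∀ (a b : ℕ) (g h : ↥(unitaryGroupOfForm σ J)), g ∈ Ω a → h ∈ Ω b → g * h ∈ Ω (a + b))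

include hσc hσv hϖ hmem hinv hmul in
/-- **THEOREM 20 (HARISH-CHANDRA'S CUSP-FORM CANCELLATION) FOR `U(σ, Φ₂)(K)`.**  Let `K₀ := K_{|ϖ|^m} ∩ U` (`m ≥ 1`), `y ∈ Ω_s`, `K′ := K₀ ⊓ y⁻¹K₀y = K₀(y⁻¹)`, `E` a real
Banach space, `f : U → E` CONTINUOUS with `supp f ⊆ C·T` (`T = torusU`, `C ⊆ Ω_{m_C}`) and CUSPIDAL along `N = unipotentU` and `N̄ = w₀Nw₀` (for left Haar measures
`ν`, `ν̄` on them), `μ` a left Haar measure on `U`.  Then for every `x ∉ Ω_{m_C + (m + 2s + 4m_C) + s}`:  **`∫_{k ∈ K′} f(x y k) dμ(k) = 0`.**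
This is ★ (T20-e1) `cuspForm_cancellation_conjLevel` with `G := U`, `A := T`, `A^± := {diag d : |d₀| ≷ 1}`, `L j := K_{|ϖ|^j}`, all structural hypotheses discharged
from ★ (T20-c) §Twist, ★ (T20-e2)-discharge FILE 1∕2 at `Φ₂` (this seat) and ★ `F0P3cIwahoriDatumU2.isCompact_level` ∕ `isOpen_level`. [cite: HarishChandra1970, Part VII §2 Theorem 20 p. 70; §8 pp. 80–84]
[cite: Casselman1995, Prop. 1.4.3–1.4.4] [cite: Rogawski1990, §1.10 p. 9] -/
theorem cuspForm_cancellation_U2 {m : ℕ} (hm : 1 ≤ m) {s : ℕ} {y : ↥(unitaryGroupOfForm σ J)} (hy : y ∈ Ω s)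
    {E : Type*} [NormedAddCommGroup E] [NormedSpace ℝ E]
    (f : ↥(unitaryGroupOfForm σ J) → E) (hf : Continuous f) (C : Set ↥(unitaryGroupOfForm σ J)) {mC : ℕ} (hC : C ⊆ Ω mC)
    (hsupp : ∀ g, f g ≠ 0 → g ∈ C * (((borelTriple σ J hJ).M : Subgroup ↥(unitaryGroupOfForm σ J)) : Set ↥(unitaryGroupOfForm σ J)))
    (hcusp : ∀ x : ↥(unitaryGroupOfForm σ J), ∫ n : ↥((borelTriple σ J hJ).N), f (x * ↑n) ∂ν = 0)
    (hcuspbar : ∀ x : ↥(unitaryGroupOfForm σ J), ∫ v : ↥(((borelTriple σ J hJ).N).map (MulAut.conj (weylLongU σ hJ)).toMonoidHom), f (x * ↑v) ∂νbar = 0)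
    {x : ↥(unitaryGroupOfForm σ J)} (hx : x ∉ Ω (mC + (m + 2 * s + 4 * mC) + s)) :
    ∫ k in (((congruenceGL 2 (valuation K ϖ ^ m)).comap (unitaryGroupOfForm σ J).subtype ⊓
        ((congruenceGL 2 (valuation K ϖ ^ m)).comap (unitaryGroupOfForm σ J).subtype).map (MulAut.conj y⁻¹).toMonoidHom :
          Subgroup ↥(unitaryGroupOfForm σ J)) : Set ↥(unitaryGroupOfForm σ J)), f (x * y * k) ∂μ = 0 := by
  -- the level `γ = |ϖ|^m`: `0 ≠ γ < 1`, `γ ≤ 1`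
  have hϖv1 : valuation K ϖ < 1 := by
    rw [← v_lt_one_iff_valuation_lt_one, hϖ, ← WithZero.exp_zero, WithZero.exp_lt_exp]; norm_num
  have hϖv0 : valuation K ϖ ≠ 0 :=
    (Valuation.ne_zero_iff _).2 (Literature.NumberTheory.Automorphic.CartanUnique.uniformizer_ne_zero hϖ)
  have hγ1 : valuation K ϖ ^ m < 1 := pow_lt_one₀ zero_le hϖv1 (by omega)
  have hγ0 : valuation K ϖ ^ m ≠ 0 := pow_ne_zero _ hϖv0
  have hγle : valuation K ϖ ^ m ≤ 1 := hγ1.le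
  obtain ⟨hK'c, hK'o⟩ := isCompact_isOpen_conjLevel σ hσc hγ0 y
  have hyΩ := (hmem s y).1 hy
  refine K2E3CuspFormCancellationCore.cuspForm_cancellation_conjLevel μ Ω
    ((congruenceGL 2 (valuation K ϖ ^ m)).comap (unitaryGroupOfForm σ J).subtype) _ (borelTriple σ J hJ).M (borelTriple σ J hJ).N
    (((borelTriple σ J hJ).N).map (MulAut.conj (weylLongU σ hJ)).toMonoidHom) (borelTriple σ J hJ).M
    {a : ↥(unitaryGroupOfForm σ J) | ∃ d : Fin 2 → Kˣ, glDiagonal 2 K d = (a : GL (Fin 2) K) ∧ 1 ≤ Valued.v (d 0 : K)}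
    {a : ↥(unitaryGroupOfForm σ J) | ∃ d : Fin 2 → Kˣ, glDiagonal 2 K d = (a : GL (Fin 2) K) ∧ Valued.v (d 0 : K) ≤ 1}
    (fun j => (congruenceGL 2 (valuation K ϖ ^ j)).comap (unitaryGroupOfForm σ J).subtype) ν νbar
    (fun hg hg' => hmul _ _ _ _ hg hg') (fun hg => hinv _ _ hg)
    (coe_level_subset_heightBall_zero σ Ω hmem _) hy (mem_inf_map_conj_inv_iff _ y) (fun u hu => ?_) hK'o hK'c
    (isClosed_coe_N σ hJ) (isClosed_coe_Nbar σ hJ) f hf C hC hsupp hcusp hcuspbar (torusU_mem_plus_or_minus σ hJ)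
    (fun k hk => ?_) (fun k hk => ?_)
    (fun a ha t ht => conj_mem_level_of_mem_torusU σ hJ _ ha ht)
    (fun a ha n hn => conj_mem_N_of_mem_torusU σ hJ ha hn) (fun a ha v hv => conj_mem_Nbar_of_mem_torusU σ hJ ha hv)
    (mem_heightBall_two_mul_of_mul_mem_N σ Ω hmem hinv hmul hJ) (mem_heightBall_two_mul_of_mul_mem_Nbar σ Ω hmem hinv hmul hJ)
    (conj_mem_level_of_plus_of_mem_Nbar σ hσv hJ hγle) (inv_conj_mem_level_of_plus_of_mem_N σ hσv hJ hϖ Ω hmem hinv)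
    (conj_mem_level_of_minus_of_mem_N σ hσv hJ hγle) (inv_conj_mem_level_of_minus_of_mem_Nbar σ hσv hJ hϖ Ω hmem hinv) hx
  · -- `hdeep`: the deep level `K_{|ϖ|^{m+2s}}` lies in `K₀ ∩ y⁻¹K₀y` (★ (T20-c) §3)
    exact ⟨(Subgroup.mem_inf.1 (K2E3IwahoriFactorisedLevelU3.comap_congruenceGL_le_inf_map_conj_of_heightBall σ hϖ m s hyΩ hu)).1,
      (K2E3IwahoriFactorisedLevelU3.conj_mem_comap_congruenceGL_of_heightBall σ hϖ m s hyΩ hu).1⟩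
  · -- `hIw`: the `N̄ · T · N` Iwahori order (★ `coe_comap_congruenceGL_eq_mul` via ★ (T20-c))
    obtain ⟨⟨nb, t, n, hnb, ht, hn, h⟩, -⟩ := K2E3CuspFormCancellationU2Torus.exists_iwahori_factorisations_of_mem_level σ hJ hγ1 hk
    exact ⟨nb, hnb, t, ht, n, hn, h⟩
  · -- `hIw'`: the `N · T · N̄` order (★ (T20-c) `coe_comap_congruenceGL_eq_mul_rev`)
    obtain ⟨-, ⟨n, t, nb, hn, ht, hnb, h⟩⟩ := K2E3CuspFormCancellationU2Torus.exists_iwahori_factorisations_of_mem_level σ hJ hγ1 hk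
    exact ⟨n, hn, t, ht, nb, hnb, h⟩

end ConjLevel

/-! ## §3 The full level `K₁ = U ∩ GL₂(𝒪)`; compact-exhaustion ∕ compact-support shapes -/

section LevelOne

variable [MeasurableSpace ↥(unitaryGroupOfForm σ J)] [BorelSpace ↥(unitaryGroupOfForm σ J)]
  [SecondCountableTopology ↥(unitaryGroupOfForm σ J)] [LocallyCompactSpace ↥(unitaryGroupOfForm σ J)]
  (μ : Measure ↥(unitaryGroupOfForm σ J)) [μ.IsHaarMeasure] [μ.IsMulRightInvariant]
  (ν : Measure ↥((borelTriple σ J hJ).N)) [SFinite ν] [ν.IsOpenPosMeasure] [IsFiniteMeasureOnCompacts ν] [ν.IsMulLeftInvariant]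
  (νbar : Measure ↥(((borelTriple σ J hJ).N).map (MulAut.conj (weylLongU σ hJ)).toMonoidHom))
  [SFinite νbar] [νbar.IsOpenPosMeasure] [IsFiniteMeasureOnCompacts νbar] [νbar.IsMulLeftInvariant]
  {ϖ : K} (hϖ : Valued.v ϖ = WithZero.exp (-1 : ℤ))

include hσc hσv hϖ in
/-- **THEOREM 20 FOR `U(σ, Φ₂)(K)` ON THE FULL LEVEL `K₁ = K_{γ=1} ∩ U = U ∩ GL₂(𝒪)`** (print p. 71: «`∫_{K₁} f_γ(x k y₀) dk = 0` unless …»): `Ω` any family with ★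
p856390's membership ∕ inversion ∕ submultiplicativity clauses, `μ` left AND right invariant Haar, `ν∕ν̄` left Haar on `↥N∕↥N̄`, `f : U → E` continuous with `supp f ⊆ C·T`,
`C ⊆ Ω_{m_C}`, cusp along `N` and `N̄`.  Then for `y ∈ Ω_s` and `x ∉ Ω_{m_C + (1 + 2s + 4m_C) + s}`:  **`∫_{k ∈ K₁} f(x k y) dμ(k) = 0`** (★ (T20-e1′)
`cuspForm_cancellation_levelOne` at `K₀ := K_{|ϖ|} ∩ U`, all structural hypotheses discharged as in ★ `cuspForm_cancellation_U2`).
[cite: HarishChandra1970, Part VII §2 Theorem 20 p. 70; §3 p. 71; §8 pp. 80–84] [cite: Folland1995, §2.4] -/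
theorem cuspForm_cancellation_levelOne_U2 (Ω : ℕ → Set ↥(unitaryGroupOfForm σ J))
    (hmem : ∀ (m : ℕ) (g : ↥(unitaryGroupOfForm σ J)), g ∈ Ω m ↔
      (∀ i j, Valued.v (ϖ ^ m * ((g : GL (Fin 2) K) : Matrix (Fin 2) (Fin 2) K) i j) ≤ 1) ∧
        ∀ i j, Valued.v (ϖ ^ m * (((g : GL (Fin 2) K)⁻¹ : GL (Fin 2) K) : Matrix (Fin 2) (Fin 2) K) i j) ≤ 1)
    (hinv : ∀ (m : ℕ) (g : ↥(unitaryGroupOfForm σ J)), g ∈ Ω m → g⁻¹ ∈ Ω m)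
    (hmul : ∀ (a b : ℕ) (g h : ↥(unitaryGroupOfForm σ J)), g ∈ Ω a → h ∈ Ω b → g * h ∈ Ω (a + b))
    {s : ℕ} {y : ↥(unitaryGroupOfForm σ J)} (hy : y ∈ Ω s)
    {E : Type*} [NormedAddCommGroup E] [NormedSpace ℝ E]
    (f : ↥(unitaryGroupOfForm σ J) → E) (hf : Continuous f) (C : Set ↥(unitaryGroupOfForm σ J)) {mC : ℕ} (hC : C ⊆ Ω mC)
    (hsupp : ∀ g, f g ≠ 0 → g ∈ C * (((borelTriple σ J hJ).M : Subgroup ↥(unitaryGroupOfForm σ J)) : Set ↥(unitaryGroupOfForm σ J)))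
    (hcusp : ∀ x : ↥(unitaryGroupOfForm σ J), ∫ n : ↥((borelTriple σ J hJ).N), f (x * ↑n) ∂ν = 0)
    (hcuspbar : ∀ x : ↥(unitaryGroupOfForm σ J), ∫ v : ↥(((borelTriple σ J hJ).N).map (MulAut.conj (weylLongU σ hJ)).toMonoidHom), f (x * ↑v) ∂νbar = 0)
    {x : ↥(unitaryGroupOfForm σ J)} (hx : x ∉ Ω (mC + (1 + 2 * s + 4 * mC) + s)) :
    ∫ k in (((congruenceGL 2 (1 : ValueGroupWithZero K)).comap (unitaryGroupOfForm σ J).subtype : Subgroup ↥(unitaryGroupOfForm σ J)) :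
      Set ↥(unitaryGroupOfForm σ J)), f (x * k * y) ∂μ = 0 := by
  -- the level `γ = |ϖ|`: `0 ≠ γ < 1`
  have hϖv1 : valuation K ϖ < 1 := by
    rw [← v_lt_one_iff_valuation_lt_one, hϖ, ← WithZero.exp_zero, WithZero.exp_lt_exp]; norm_num
  have hϖv0 : valuation K ϖ ≠ 0 :=
    (Valuation.ne_zero_iff _).2 (Literature.NumberTheory.Automorphic.CartanUnique.uniformizer_ne_zero hϖ)
  have hγ1 : valuation K ϖ ^ 1 < 1 := by rw [pow_one]; exact hϖv1
  have hγ0 : valuation K ϖ ^ 1 ≠ 0 := pow_ne_zero _ hϖv0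
  have hγle : valuation K ϖ ^ 1 ≤ 1 := hγ1.le
  obtain ⟨hK₁c, hK₁o⟩ : IsCompact _ ∧ IsOpen _ :=
    ⟨F0P3cIwahoriDatumU2.isCompact_level σ hσc (1 : ValueGroupWithZero K) (J := J),
      F0P3cIwahoriDatumU2.isOpen_level σ (one_ne_zero : (1 : ValueGroupWithZero K) ≠ 0) (J := J)⟩
  have hK₀o := F0P3cIwahoriDatumU2.isOpen_level σ hγ0 (J := J)
  have hyΩ := (hmem s y).1 hy
  refine K2E3CuspFormCancellationLevelOne.cuspForm_cancellation_levelOne μ Ω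
    ((congruenceGL 2 (1 : ValueGroupWithZero K)).comap (unitaryGroupOfForm σ J).subtype)
    ((congruenceGL 2 (valuation K ϖ ^ 1)).comap (unitaryGroupOfForm σ J).subtype) (borelTriple σ J hJ).M (borelTriple σ J hJ).N
    (((borelTriple σ J hJ).N).map (MulAut.conj (weylLongU σ hJ)).toMonoidHom) (borelTriple σ J hJ).M
    {a : ↥(unitaryGroupOfForm σ J) | ∃ d : Fin 2 → Kˣ, glDiagonal 2 K d = (a : GL (Fin 2) K) ∧ 1 ≤ Valued.v (d 0 : K)}
    {a : ↥(unitaryGroupOfForm σ J) | ∃ d : Fin 2 → Kˣ, glDiagonal 2 K d = (a : GL (Fin 2) K) ∧ Valued.v (d 0 : K) ≤ 1}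
    (fun j => (congruenceGL 2 (valuation K ϖ ^ j)).comap (unitaryGroupOfForm σ J).subtype) ν νbar
    (fun hg hg' => hmul _ _ _ _ hg hg') (fun hg => hinv _ _ hg)
    (coe_level_subset_heightBall_zero σ Ω hmem _) (Subgroup.comap_mono (congruenceGL_mono hγle)) hy (fun u hu => ?_) hK₁o hK₁c hK₀o
    (isClosed_coe_N σ hJ) (isClosed_coe_Nbar σ hJ) f hf C hC hsupp hcusp hcuspbar (torusU_mem_plus_or_minus σ hJ)
    (fun k hk => ?_) (fun k hk => ?_)
    (fun a ha t ht => conj_mem_level_of_mem_torusU σ hJ _ ha ht)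
    (fun a ha n hn => conj_mem_N_of_mem_torusU σ hJ ha hn) (fun a ha v hv => conj_mem_Nbar_of_mem_torusU σ hJ ha hv)
    (mem_heightBall_two_mul_of_mul_mem_N σ Ω hmem hinv hmul hJ) (mem_heightBall_two_mul_of_mul_mem_Nbar σ Ω hmem hinv hmul hJ)
    (conj_mem_level_of_plus_of_mem_Nbar σ hσv hJ hγle) (inv_conj_mem_level_of_plus_of_mem_N σ hσv hJ hϖ Ω hmem hinv)
    (conj_mem_level_of_minus_of_mem_N σ hσv hJ hγle) (inv_conj_mem_level_of_minus_of_mem_Nbar σ hσv hJ hϖ Ω hmem hinv) hx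
  · exact ⟨(Subgroup.mem_inf.1 (K2E3IwahoriFactorisedLevelU3.comap_congruenceGL_le_inf_map_conj_of_heightBall σ hϖ 1 s hyΩ hu)).1,
      (K2E3IwahoriFactorisedLevelU3.conj_mem_comap_congruenceGL_of_heightBall σ hϖ 1 s hyΩ hu).1⟩
  · obtain ⟨⟨nb, t, n, hnb, ht, hn, h⟩, -⟩ := K2E3CuspFormCancellationU2Torus.exists_iwahori_factorisations_of_mem_level σ hJ hγ1 hk
    exact ⟨nb, hnb, t, ht, n, hn, h⟩
  · obtain ⟨-, ⟨n, t, nb, hn, ht, hnb, h⟩⟩ := K2E3CuspFormCancellationU2Torus.exists_iwahori_factorisations_of_mem_level σ hJ hγ1 hk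
    exact ⟨n, hn, t, ht, nb, hnb, h⟩

include hσc hσv hϖ in
/-- **THEOREM 20 FOR `U(σ, Φ₂)(K)` ON `K₁`, COMPACT-EXHAUSTION ∕ COMPACT-SUPPORT SHAPE**: `Ω : CompactExhaustion U` with ★ p856390's three clauses, `f` continuous with
`∃ C, IsCompact C ∧ supp f ⊆ C·T` (★ (T20-b)'s shape), cusp along `N`, `N̄`; then **`∃ m_C, ∀ s y, y ∈ Ω_s → ∀ x ∉ Ω_{m_C + (1 + 2s + 4m_C) + s}, ∫_{K₁} f(x k y) dμ = 0`**
(the compact `C` is swallowed by some `Ω_{m_C}`, `CompactExhaustion.exists_superset_of_isCompact`). [cite: HarishChandra1970, Part VII §2 Theorem 20 p. 70; §3 p. 71] -/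
theorem cuspForm_cancellation_levelOne_U2_of_isCompact (Ω : CompactExhaustion ↥(unitaryGroupOfForm σ J))
    (hmem : ∀ (m : ℕ) (g : ↥(unitaryGroupOfForm σ J)), g ∈ Ω m ↔
      (∀ i j, Valued.v (ϖ ^ m * ((g : GL (Fin 2) K) : Matrix (Fin 2) (Fin 2) K) i j) ≤ 1) ∧
        ∀ i j, Valued.v (ϖ ^ m * (((g : GL (Fin 2) K)⁻¹ : GL (Fin 2) K) : Matrix (Fin 2) (Fin 2) K) i j) ≤ 1)
    (hinv : ∀ (m : ℕ) (g : ↥(unitaryGroupOfForm σ J)), g ∈ Ω m → g⁻¹ ∈ Ω m)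
    (hmul : ∀ (a b : ℕ) (g h : ↥(unitaryGroupOfForm σ J)), g ∈ Ω a → h ∈ Ω b → g * h ∈ Ω (a + b))
    {E : Type*} [NormedAddCommGroup E] [NormedSpace ℝ E]
    (f : ↥(unitaryGroupOfForm σ J) → E) (hf : Continuous f)
    (hsupp : ∃ C : Set ↥(unitaryGroupOfForm σ J), IsCompact C ∧ ∀ g, f g ≠ 0 → g ∈ C * ((torusU σ J : Subgroup ↥(unitaryGroupOfForm σ J)) : Set ↥(unitaryGroupOfForm σ J)))
    (hcusp : ∀ x : ↥(unitaryGroupOfForm σ J), ∫ n : ↥((borelTriple σ J hJ).N), f (x * ↑n) ∂ν = 0)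
    (hcuspbar : ∀ x : ↥(unitaryGroupOfForm σ J), ∫ v : ↥(((borelTriple σ J hJ).N).map (MulAut.conj (weylLongU σ hJ)).toMonoidHom), f (x * ↑v) ∂νbar = 0) :
    ∃ mC : ℕ, ∀ (s : ℕ) (y : ↥(unitaryGroupOfForm σ J)), y ∈ Ω s → ∀ x : ↥(unitaryGroupOfForm σ J), x ∉ Ω (mC + (1 + 2 * s + 4 * mC) + s) →
      ∫ k in (((congruenceGL 2 (1 : ValueGroupWithZero K)).comap (unitaryGroupOfForm σ J).subtype : Subgroup ↥(unitaryGroupOfForm σ J)) :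
        Set ↥(unitaryGroupOfForm σ J)), f (x * k * y) ∂μ = 0 := by
  obtain ⟨C, hCc, hC⟩ := hsupp
  obtain ⟨mC, hmC⟩ := Ω.exists_superset_of_isCompact hCc
  exact ⟨mC, fun s y hy x hx => cuspForm_cancellation_levelOne_U2 σ hσc hσv hJ μ ν νbar hϖ Ω hmem hinv hmul hy f hf C hmC hC hcusp hcuspbar hx⟩

include hσc hσv hϖ in
omit [μ.IsMulRightInvariant] in
/-- **THEOREM 20 FOR `U(σ, Φ₂)(K)` AT THE CONJUGATE LEVEL `K_m(y⁻¹) = K_m ⊓ y⁻¹K_m y`, COMPACT-EXHAUSTION ∕ COMPACT-SUPPORT SHAPE** (`μ` only a left Haar measure here): for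
`1 ≤ m`, `∃ m_C, ∀ s y, y ∈ Ω_s → ∀ x ∉ Ω_{m_C + (m + 2s + 4m_C) + s}, ∫_{K_m(y⁻¹)} f(x y k) dμ = 0` (§2 `cuspForm_cancellation_U2`).
[cite: HarishChandra1970, Part VII §2 Theorem 20 p. 70; §8 pp. 80–84] -/
theorem cuspForm_cancellation_U2_of_isCompact (Ω : CompactExhaustion ↥(unitaryGroupOfForm σ J))
    (hmem : ∀ (m : ℕ) (g : ↥(unitaryGroupOfForm σ J)), g ∈ Ω m ↔
      (∀ i j, Valued.v (ϖ ^ m * ((g : GL (Fin 2) K) : Matrix (Fin 2) (Fin 2) K) i j) ≤ 1) ∧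
        ∀ i j, Valued.v (ϖ ^ m * (((g : GL (Fin 2) K)⁻¹ : GL (Fin 2) K) : Matrix (Fin 2) (Fin 2) K) i j) ≤ 1)
    (hinv : ∀ (m : ℕ) (g : ↥(unitaryGroupOfForm σ J)), g ∈ Ω m → g⁻¹ ∈ Ω m)
    (hmul : ∀ (a b : ℕ) (g h : ↥(unitaryGroupOfForm σ J)), g ∈ Ω a → h ∈ Ω b → g * h ∈ Ω (a + b))
    {m : ℕ} (hm : 1 ≤ m) {E : Type*} [NormedAddCommGroup E] [NormedSpace ℝ E]
    (f : ↥(unitaryGroupOfForm σ J) → E) (hf : Continuous f)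
    (hsupp : ∃ C : Set ↥(unitaryGroupOfForm σ J), IsCompact C ∧ ∀ g, f g ≠ 0 → g ∈ C * ((torusU σ J : Subgroup ↥(unitaryGroupOfForm σ J)) : Set ↥(unitaryGroupOfForm σ J)))
    (hcusp : ∀ x : ↥(unitaryGroupOfForm σ J), ∫ n : ↥((borelTriple σ J hJ).N), f (x * ↑n) ∂ν = 0)
    (hcuspbar : ∀ x : ↥(unitaryGroupOfForm σ J), ∫ v : ↥(((borelTriple σ J hJ).N).map (MulAut.conj (weylLongU σ hJ)).toMonoidHom), f (x * ↑v) ∂νbar = 0) :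
    ∃ mC : ℕ, ∀ (s : ℕ) (y : ↥(unitaryGroupOfForm σ J)), y ∈ Ω s → ∀ x : ↥(unitaryGroupOfForm σ J), x ∉ Ω (mC + (m + 2 * s + 4 * mC) + s) →
      ∫ k in (((congruenceGL 2 (valuation K ϖ ^ m)).comap (unitaryGroupOfForm σ J).subtype ⊓
          ((congruenceGL 2 (valuation K ϖ ^ m)).comap (unitaryGroupOfForm σ J).subtype).map (MulAut.conj y⁻¹).toMonoidHom :
            Subgroup ↥(unitaryGroupOfForm σ J)) : Set ↥(unitaryGroupOfForm σ J)), f (x * y * k) ∂μ = 0 := by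
  obtain ⟨C, hCc, hC⟩ := hsupp
  obtain ⟨mC, hmC⟩ := Ω.exists_superset_of_isCompact hCc
  exact ⟨mC, fun s y hy x hx => cuspForm_cancellation_U2 σ hσc hσv hJ μ ν νbar hϖ Ω hmem hinv hmul hm hy f hf C hmC hC hcusp hcuspbar hx⟩

end LevelOne

end Model

end Summit.HodgeConjecture.HodgeConjecture.Cruxes.H413.K2E3CuspFormCancellationU2LevelOne

end
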